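import Summits.AtomisticToContinuum.Crystallization.Theorems.FrustratedLawDichotomyPairPotentialDoor

/-!
# FrustratedLawDichotomy · the motif door for the ELASTIC currency (credits of BOTH signs): E′♭ from motif certificates,
# hence the whole energetic residual of column 27623 from SF ∧ UP ∧ TWO local rules with FINITE motif families

`…MotifDoor` / `…PairPotentialDoor` (hand-2 g12) pass motif certificates to the cluster when every indicator credit is NONPOSITIVE (T′, FRG classes):
a CAPPED-good motif centre is good in the cluster (`goodAt_of_motif`).  The ELASTIC class `E′♭ = SchurElasticPricing` has a POSITIVE coefficient
`κ_E + D_E` on `𝟙[η₁-good]` (strained sites pay, topological sites are credited), which needs the OPPOSITE direction: a cluster-good site must be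
seen as (possibly) good from the motif.  This file supplies it:

* §1 `clauses_restrict` / ★ `goodAtScale_restrict` — a CAPPED-good cluster site is capped-good in every deep motif around it (`ϱ ≥ 13/10·D + 1`,
  tolerance `η ≤ 3/10` so that the twelve matched atoms, at distance `≤ (1+η)·d`, lie inside the motif);
* §2 `MaybeGoodAt η D z c := GoodAtScale η D z c ∨ (no other motif atom within D of the centre)` — the motif's OVER-approximation of cluster
  goodness — and ★ `maybeGood_of_goodAt : GoodAt η y i → MaybeGoodAt η D z c` (uncapped cluster goodness at a scale `> D` shows in the motif as
  «no neighbour within D»);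
* §3 `PairRuleMotifCertificateE η₀ η₁ W A c₀ cneg cpos D ϱ F` — the per-motif inequality with level
  `c₀ + cneg·𝟙[GoodAtScale η₀ D] + cpos·𝟙[MaybeGoodAt η₁ D]`, `cneg ≤ 0 ≤ cpos` — and ★★ the door `pairRuleCertificate_of_motifE`
  (⟹ `PairRuleCertificate η₀ η₁ W A c₀ cneg cpos R′ ρ B F`), hence `schurElasticPricing_of_motifE`
  (`(c₀, cneg, cpos) = (eUp − D_E, −(κ_E + C_E), κ_E + D_E)`);
* §4 ★★ `aperiodicFrustratedLawGap_of_schurMotifs_five` — the crux from `MuEquilibriumDoor ∧ SF₅ ∧ UP(−0.7175)` and TWO motif-certified local rules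
  (`F_T` beneath T′♭₅, `F_E` beneath E′♭₅): after this, EVERY hypothesis of the energetic feed of column 27623 other than the two finite motif
  families is a tree theorem (Door p816834, SF₅ KNOWN·CERTIFIED modulo TAG 181-S(i), UP a tree number) — plus the generic `…_of_schurMotifs`.

[folklore] bookkeeping; 0 sorry.  Prover hand 2, gen 12 (decomp-a2c), `--supports stmt-AtomisticToContinuum-27623`.
-/

noncomputable section

namespace Summit.AtomisticToContinuum.Crystallization.Theorems.FrustratedLawDichotomyMotifDoorE

open scoped BigOperators Classical
open Literature.MathematicalPhysics.StatisticalMechanics (interactionEnergy lennardJones)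
open Literature.Geometry.DiscreteGeometry (nearestDist nearestDist_le_dist le_nearestDist)
open Summit.AtomisticToContinuum.Crystallization.Theorems.ChargedEnergyGapNegative (E3 eStar)
open Summit.AtomisticToContinuum.Crystallization.Theorems.FrustratedLawDichotomyRangeCut
open Summit.AtomisticToContinuum.Crystallization.Theorems.FrustratedLawDichotomyLocalPricing (sum_le_sum_of_transfers goodCount_eq_sum)
open Summit.AtomisticToContinuum.Crystallization.Theorems.FrustratedLawDichotomyLocalDischargingRule
open Summit.AtomisticToContinuum.Crystallization.Theorems.FrustratedLawDichotomyMotifLemmas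
open Summit.AtomisticToContinuum.Crystallization.Theorems.FrustratedLawDichotomySchurCut
open Summit.AtomisticToContinuum.Crystallization.Theorems.FrustratedLawDichotomyPairPotentialDoor

/-! ## §1. Restriction: a capped-good cluster site is capped-good in every deep motif around it -/

/-- The clause list of the fit predicate RESTRICTS from `Xy` to a subset `Xz ∋` (every point of `Xy` within `ϱ` of the centre), keeping the same data,
provided the matched atoms fit inside: `(1 + η')·d ≤ ϱ` (here from `η' ≤ 3/10`, `d ≤ D`, `13/10·D + 1 ≤ ϱ`) and `d ≤ ϱ`. [folklore] -/
theorem clauses_restrict {P : Type*} (v : P → E3) (hv : ∀ u, ‖v u‖ = 1) {Xz Xy : Set E3} {p : E3} {ϱ D d η' ηmax γ : ℝ}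
    {A : E3 →ₗᵢ[ℝ] E3} {t : P → E3}
    (hsub : Xz ⊆ Xy) (hball : ∀ s ∈ Xy, dist s p ≤ ϱ → s ∈ Xz) (hdeep : 13 / 10 * D + 1 ≤ ϱ) (hdD : d ≤ D) (hηmax : ηmax ≤ 3 / 10)
    (h : 0 < d ∧ 0 < γ ∧ η' < ηmax ∧ (∀ u, t u ∈ Xy ∧ ‖(t u - p) - d • A (v u)‖ ≤ η' * d) ∧ (∀ s, s ∈ Xy → s ≠ p → d ≤ dist s p) ∧
      (∃ s, s ∈ Xy ∧ s ≠ p ∧ dist s p ≤ d) ∧ (∀ s, s ∈ Xy → s ≠ p → dist s p < 13 / 10 * d + γ → dist s p ≤ 13 / 10 * d - γ ∧ s ∈ Set.range t)) :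
    0 < d ∧ 0 < γ ∧ η' < ηmax ∧ (∀ u, t u ∈ Xz ∧ ‖(t u - p) - d • A (v u)‖ ≤ η' * d) ∧ (∀ s, s ∈ Xz → s ≠ p → d ≤ dist s p) ∧
      (∃ s, s ∈ Xz ∧ s ≠ p ∧ dist s p ≤ d) ∧ (∀ s, s ∈ Xz → s ≠ p → dist s p < 13 / 10 * d + γ → dist s p ≤ 13 / 10 * d - γ ∧ s ∈ Set.range t) := by
  obtain ⟨hd, hγ, hη, ht, hnn₁, hnn₂, hgap⟩ := h
  refine ⟨hd, hγ, hη, fun u => ⟨?_, (ht u).2⟩, fun s hs hsp => hnn₁ s (hsub hs) hsp, ?_, fun s hs hsp hlt => hgap s (hsub hs) hsp hlt⟩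
  · -- the matched atom `t u` lies within `(1 + η')·d ≤ ϱ` of the centre
    apply hball _ (ht u).1
    have h1 : dist (t u) p = ‖(t u - p)‖ := by rw [dist_eq_norm]
    have h2 : ‖t u - p‖ ≤ ‖(t u - p) - d • A (v u)‖ + ‖d • A (v u)‖ := by
      have := norm_add_le ((t u - p) - d • A (v u)) (d • A (v u))
      rwa [sub_add_cancel] at this
    have h3 : ‖d • A (v u)‖ = d := by
      rw [norm_smul, A.norm_map, hv u, mul_one, Real.norm_eq_abs, abs_of_pos hd]
    have h4 : η' * d ≤ 3 / 10 * d := mul_le_mul_of_nonneg_right (by linarith) hd.le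
    rw [h1]
    nlinarith [(ht u).2]
  · obtain ⟨s, hs, hsp, hle⟩ := hnn₂
    exact ⟨s, hball s hs (by nlinarith), hsp, hle⟩

/-- The pattern points are unit vectors (fcc). [folklore] -/
theorem norm_fccPattern (u : ↥Literature.Geometry.DiscreteGeometry.fccKissingPattern) : ‖(u : E3)‖ = 1 :=
  Literature.Geometry.DiscreteGeometry.norm_eq_one_of_mem_fccKissingPattern u.2

/-- The pattern points are unit vectors (hcp). [folklore] -/
theorem norm_hcpPattern (u : ↥Literature.Geometry.DiscreteGeometry.hcpKissingPattern) : ‖(u : E3)‖ = 1 :=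
  Literature.Geometry.DiscreteGeometry.norm_eq_one_of_mem_hcpKissingPattern u.2

/-- ★ **RESTRICTION**: `z = y ∘ φ` a sub-cluster containing every atom of `y` within `ϱ` of `y (φ c)`, `13/10·D + 1 ≤ ϱ`, tolerance `η ≤ 3/10`;
then `GoodAtScale η D y (φ c) → GoodAtScale η D (y ∘ φ) c`. [folklore] -/
theorem goodAtScale_restrict {η D ϱ : ℝ} {N M : ℕ} {y : Fin N → E3} {φ : Fin M → Fin N} {c : Fin M}
    (hS : ∀ k : Fin N, dist (y k) (y (φ c)) ≤ ϱ → k ∈ Set.range φ) (hdeep : 13 / 10 * D + 1 ≤ ϱ) (hη : η ≤ 3 / 10)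
    (h : GoodAtScale η D y (φ c)) : GoodAtScale η D (y ∘ φ) c := by
  obtain ⟨d, η', γ, A, hdD, hor⟩ := h
  have hsub : Set.range (y ∘ φ) ⊆ Set.range y := Set.range_comp_subset_range φ y
  have hball : ∀ s ∈ Set.range y, dist s (y (φ c)) ≤ ϱ → s ∈ Set.range (y ∘ φ) := by
    rintro s ⟨k, rfl⟩ hk
    obtain ⟨a, ha⟩ := hS k hk
    exact ⟨a, by simp [ha]⟩
  refine ⟨d, η', γ, A, hdD, ?_⟩
  show (∃ t, _) ∨ (∃ t, _)
  rcases hor with ⟨t, h⟩ | ⟨t, h⟩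
  · exact Or.inl ⟨t, clauses_restrict (fun u : ↥Literature.Geometry.DiscreteGeometry.fccKissingPattern => (u : E3)) norm_fccPattern
      hsub hball hdeep hdD hη h⟩
  · exact Or.inr ⟨t, clauses_restrict (fun u : ↥Literature.Geometry.DiscreteGeometry.hcpKissingPattern => (u : E3)) norm_hcpPattern
      hsub hball hdeep hdD hη h⟩

/-! ## §2. The motif's over-approximation of cluster goodness -/

/-- **`MaybeGoodAt η D z c`**: the centre is capped-good in the motif, OR the motif shows no other atom within `D` of it (then the cluster site may be
good at a scale `> D`, which the motif cannot see — so it is COUNTED as good wherever goodness COSTS). -/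
def MaybeGoodAt (η D : ℝ) {M : ℕ} (z : Fin M → E3) (c : Fin M) : Prop :=
  GoodAtScale η D z c ∨ ∀ a : Fin M, a ≠ c → D < dist (z a) (z c)

/-- ★ **Cluster-good ⟹ maybe-good in every deep motif** (`y` injective, `η ≤ 3/10`, `13/10·D + 1 ≤ ϱ`). [folklore] -/
theorem maybeGood_of_goodAt {η D ϱ : ℝ} {N M : ℕ} {y : Fin N → E3} (hy : Function.Injective y) {φ : Fin M → Fin N}
    (hφ : Function.Injective φ) {c : Fin M}
    (hS : ∀ k : Fin N, dist (y k) (y (φ c)) ≤ ϱ → k ∈ Set.range φ) (hdeep : 13 / 10 * D + 1 ≤ ϱ) (hη : η ≤ 3 / 10)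
    (h : GoodAt η y (φ c)) : MaybeGoodAt η D (y ∘ φ) c := by
  obtain ⟨d, η', γ, A, hor⟩ := h
  -- the two pinning clauses, from either branch
  have hpin : (∀ s : E3, s ∈ Set.range y → s ≠ y (φ c) → d ≤ dist s (y (φ c))) := by
    rcases hor with ⟨t, -, -, -, -, h1, -, -⟩ | ⟨t, -, -, -, -, h1, -, -⟩ <;> exact h1
  by_cases hdD : d ≤ D
  · exact Or.inl (goodAtScale_restrict hS hdeep hη ⟨d, η', γ, A, hdD, hor⟩)
  · right
    intro a hac
    have hne : y (φ a) ≠ y (φ c) := fun h => hac (hφ (hy h))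
    have := hpin (y (φ a)) ⟨φ a, rfl⟩ hne
    push Not at hdD
    show D < dist (y (φ a)) (y (φ c))
    linarith

/-! ## §3. The motif certificate with credits of both signs and its door -/

/-- **`PairRuleMotifCertificateE η₀ η₁ W A c₀ cneg cpos D ϱ F`** — per-motif inequality with level
`c₀ + cneg·𝟙[GoodAtScale η₀ D z c] + cpos·𝟙[MaybeGoodAt η₁ D z c]` (use with `cneg ≤ 0 ≤ cpos`). -/
def PairRuleMotifCertificateE (η₀ η₁ : ℝ) (W : ℝ → ℝ) (A c₀ cneg cpos D ϱ : ℝ) (F : TransferRule) : Prop :=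
  ∀ (M : ℕ) (z : Fin M → E3), Function.Injective z → Sep z → ∀ c : Fin M, (∀ a : Fin M, dist (z a) (z c) ≤ ϱ) →
    c₀ + cneg * (if GoodAtScale η₀ D z c then (1 : ℝ) else 0) + cpos * (if MaybeGoodAt η₁ D z c then (1 : ℝ) else 0) ≤
      (∑ a, W (dist (z c) (z a)) - W 0) / 2 - A + netInflow F M z c

/-- **THE MOTIF LEMMA with both directions of goodness transfer.** [folklore] -/
theorem motif_transferE {W : ℝ → ℝ} {R R' ρ ϱ A D : ℝ} {F : TransferRule} (hW : ∀ r, R ≤ r → W r = 0)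
    (hF₁ : HasRange R' F) (hF₂ : IsLocal ρ F)
    (h0 : 0 ≤ ϱ) (hR : R ≤ ϱ) (hRρ : R' + ρ ≤ ϱ) (hρ : ρ ≤ ϱ) (hR' : R' ≤ ϱ) (hD : 13 / 10 * D + 1 ≤ ϱ)
    {N : ℕ} {y : Fin N → E3} (hy : Function.Injective y) (hsep : Sep y) (i : Fin N) :
    ∃ (M : ℕ) (z : Fin M → E3) (c : Fin M), Function.Injective z ∧ Sep z ∧ (∀ a : Fin M, dist (z a) (z c) ≤ ϱ) ∧
      (∑ a, W (dist (z c) (z a)) - W 0) / 2 - A + netInflow F M z c =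
        (∑ j, W (dist (y i) (y j)) - W 0) / 2 - A + netInflow F N y i ∧
      (∀ η : ℝ, GoodAtScale η D z c → GoodAt η y i) ∧
      (∀ η : ℝ, η ≤ 3 / 10 → GoodAt η y i → MaybeGoodAt η D z c) := by
  set S : Finset (Fin N) := Finset.univ.filter (fun j => dist (y j) (y i) ≤ ϱ) with hS
  have hSdef0 : ∀ j, j ∈ S ↔ dist (y j) (y i) ≤ ϱ := fun j => by simp [hS]
  have hiS : i ∈ S := (hSdef0 i).2 (by rw [dist_self]; exact h0)
  let φ : Fin S.card ↪o Fin N := S.orderEmbOfFin rfl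
  have hφ : Set.range φ = ↑S := Finset.range_orderEmbOfFin S rfl
  have hiφ : i ∈ Set.range φ := by rw [hφ]; exact hiS
  obtain ⟨c, hc⟩ := hiφ
  have hSdef : ∀ j, j ∈ S ↔ dist (y j) (y (φ c)) ≤ ϱ := by rw [hc]; exact hSdef0
  have hSr : ∀ k : Fin N, dist (y k) (y (φ c)) ≤ ϱ → k ∈ Set.range φ := fun k hk => by
    rw [hφ]; exact (hSdef k).2 hk
  have hφinj : Function.Injective φ := φ.injective
  refine ⟨S.card, y ∘ φ, c, hy.comp hφinj, fun a b hab => hsep (φ a) (φ b) (hφinj.ne hab), fun a => ?_, ?_, fun η hη => ?_,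
    fun η hη3 hη => ?_⟩
  · have ha : φ a ∈ S := by
      have h : φ a ∈ Set.range φ := ⟨a, rfl⟩
      rw [hφ] at h
      exact h
    exact (hSdef (φ a)).1 ha
  · have e1 : ∑ a, W (dist ((y ∘ φ) c) ((y ∘ φ) a)) = ∑ j, W (dist (y (φ c)) (y j)) := pairSum_motif hW hR φ hφ hSdef
    have e3 : netInflow F S.card (y ∘ φ) c = netInflow F N y (φ c) := netInflow_motif hF₁ hF₂ hRρ hρ hR' φ hφ hSdef
    rw [e1, e3, hc]
  · rw [← hc]; exact goodAt_of_motif hSr hD hη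
  · rw [← hc] at hη; exact maybeGood_of_goodAt hy hφinj hSr hD hη3 hη

/-- ★★ **THE DOOR with credits of both signs**: `W` vanishing from `R` on, rule of range `R′`, locality `ρ`, bound `B`, motif radius
`ϱ ≥ max (R, R′ + ρ, ρ, R′, 13/10·D + 1, 0)`, `cneg ≤ 0 ≤ cpos`, `η₁ ≤ 3/10`:
`PairRuleMotifCertificateE η₀ η₁ W A c₀ cneg cpos D ϱ F ⟹ PairRuleCertificate η₀ η₁ W A c₀ cneg cpos R′ ρ B F`. [folklore] -/
theorem pairRuleCertificate_of_motifE {η₀ η₁ : ℝ} {W : ℝ → ℝ} {R A c₀ cneg cpos D ϱ R' ρ B : ℝ} {F : TransferRule}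
    (hW : ∀ r, R ≤ r → W r = 0) (hF₁ : HasRange R' F) (hF₂ : IsLocal ρ F) (hF₃ : IsBounded B F)
    (h0 : 0 ≤ ϱ) (hR : R ≤ ϱ) (hRρ : R' + ρ ≤ ϱ) (hρ : ρ ≤ ϱ) (hR' : R' ≤ ϱ) (hD : 13 / 10 * D + 1 ≤ ϱ)
    (hneg : cneg ≤ 0) (hpos : 0 ≤ cpos) (hη₁ : η₁ ≤ 3 / 10) (h : PairRuleMotifCertificateE η₀ η₁ W A c₀ cneg cpos D ϱ F) :
    PairRuleCertificate η₀ η₁ W A c₀ cneg cpos R' ρ B F := by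
  refine ⟨hF₁, hF₂, hF₃, fun N y hy hsep i => ?_⟩
  obtain ⟨M, z, c, hz, hzsep, hconf, hrhs, hgood, hmaybe⟩ := motif_transferE (A := A) hW hF₁ hF₂ h0 hR hRρ hρ hR' hD hy hsep i
  have hm := h M z hz hzsep c hconf
  rw [hrhs] at hm
  have e0 := mul_le_mul_of_nonpos_left (ite_le_ite_of_imp (hgood η₀)) hneg
  have e1 := mul_le_mul_of_nonneg_left (ite_le_ite_of_imp (hmaybe η₁ hη₁)) hpos
  linarith

/-- ★ **`E′♭ ⟸ motif certificate (class E)`** with `W = effPot w ω A` vanishing from `R` on and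
`(c₀, cneg, cpos) = (eUp − D_E, −(κ_E + C_E), κ_E + D_E)` (`0 ≤ κ_E + C_E`, `0 ≤ κ_E + D_E`, `η₁ ≤ 3/10`). [folklore chaining] -/
theorem schurElasticPricing_of_motifE {η₀ η₁ : ℝ} {w ω : ℝ → ℝ} {A eUp κE CE DE R D ϱ R' ρ B : ℝ} {F : TransferRule}
    (hW : ∀ r, R ≤ r → effPot w ω A r = 0) (hF₁ : HasRange R' F) (hF₂ : IsLocal ρ F) (hF₃ : IsBounded B F)
    (h0 : 0 ≤ ϱ) (hR : R ≤ ϱ) (hRρ : R' + ρ ≤ ϱ) (hρ : ρ ≤ ϱ) (hR' : R' ≤ ϱ) (hD : 13 / 10 * D + 1 ≤ ϱ)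
    (hneg : 0 ≤ κE + CE) (hpos : 0 ≤ κE + DE) (hη₁ : η₁ ≤ 3 / 10)
    (h : PairRuleMotifCertificateE η₀ η₁ (effPot w ω A) A (eUp - DE) (-(κE + CE)) (κE + DE) D ϱ F) :
    SchurElasticPricing η₀ η₁ w ω A eUp κE CE DE :=
  schurElasticPricing_of_rule
    (pairRuleCertificate_of_motifE hW hF₁ hF₂ hF₃ h0 hR hRρ hρ hR' hD (by linarith) hpos hη₁ h)

/-! ## §4. The crux from a Schur floor and TWO motif-certified rules -/

/-- ★★ **The crux from `MuEquilibriumDoor ∧ SF ∧ UP` and TWO motif-certified local rules** (`F_T` beneath T′♭ with level `(eUp + κ_T, −C_T, −κ_T)`,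
`F_E` beneath E′♭ with level `(eUp − D_E, −(κ_E + C_E), κ_E + D_E)`; generic `w ω A` with `effPot` vanishing from `R` on; one motif radius `ϱ` and
cap `D` for both, `η₁ ∈ [1/20, 3/10]`). [folklore chaining] -/
theorem aperiodicFrustratedLawGap_of_schurMotifs {η₁ : ℝ} {w ω : ℝ → ℝ} {A eUp κT CT κE CE DE R D ϱ R' ρ B R'' ρ' B' : ℝ}
    {FT FE : TransferRule} (h01 : (1 : ℝ) / 20 ≤ η₁) (hη₁ : η₁ ≤ 3 / 10)
    (hDoor : Summit.AtomisticToContinuum.Crystallization.Theses.GrainCoreNetworkSplit.MuEquilibriumDoor)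
    (hSF : SchurFloor w ω A) (hU : PeriodicEnergyCeiling eUp) (hκT : 0 < κT) (hκE : 0 < κE) (hCT : 0 ≤ CT) (hCE : 0 ≤ CE) (hDE : 0 ≤ DE)
    (hW : ∀ r, R ≤ r → effPot w ω A r = 0)
    (hT₁ : HasRange R' FT) (hT₂ : IsLocal ρ FT) (hT₃ : IsBounded B FT)
    (hE₁ : HasRange R'' FE) (hE₂ : IsLocal ρ' FE) (hE₃ : IsBounded B' FE)
    (h0 : 0 ≤ ϱ) (hR : R ≤ ϱ) (hRρ : R' + ρ ≤ ϱ) (hρ : ρ ≤ ϱ) (hR' : R' ≤ ϱ) (hRρ' : R'' + ρ' ≤ ϱ) (hρ'' : ρ' ≤ ϱ) (hR''' : R'' ≤ ϱ)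
    (hD : 13 / 10 * D + 1 ≤ ϱ)
    (hT : PairRuleMotifCertificate (1 / 20) η₁ (effPot w ω A) A (eUp + κT) (-CT) (-κT) D ϱ FT)
    (hE : PairRuleMotifCertificateE (1 / 20) η₁ (effPot w ω A) A (eUp - DE) (-(κE + CE)) (κE + DE) D ϱ FE) :
    Summit.AtomisticToContinuum.Crystallization.Theses.FrustratedLawDichotomy.AperiodicFrustratedLawGap :=
  aperiodicFrustratedLawGap_of_split_schurCut h01 hDoor hSF hU hκT
    (schurTopologicalPricing_of_motif hW hT₁ hT₂ hT₃ h0 hR hRρ hρ hR' hD hκT.le hCT hT) hκE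
    (schurElasticPricing_of_motifE hW hE₁ hE₂ hE₃ h0 hR hRρ' hρ'' hR''' hD (by linarith) (by linarith) hη₁ hE)

/-- ★★ **The crux at the RANGE-5 node from TWO motif-certified rules** (`SF₅`, `A = 13/4000`, `eUp = −0.7175`, `κ_T = 1/100`, `κ_E = 1/1000`,
`η₁ = 1/8`; `C_T, C_E, D_E ≥ 0` free; one motif radius `ϱ ≥ max (5, R′+ρ, ρ, R′, R″+ρ′, ρ′, R″, 13/10·D + 1)`):
after this, every hypothesis of the energetic feed of column 27623 except the two FINITE motif families is a tree theorem or a tree number.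
[folklore chaining] -/
theorem aperiodicFrustratedLawGap_of_schurMotifs_five {CT CE DE D ϱ R' ρ B R'' ρ' B' : ℝ} {FT FE : TransferRule}
    (hDoor : Summit.AtomisticToContinuum.Crystallization.Theses.GrainCoreNetworkSplit.MuEquilibriumDoor)
    (hSF : SF₅) (hU : PeriodicEnergyCeiling (-(7175 / 10000))) (hCT : 0 ≤ CT) (hCE : 0 ≤ CE) (hDE : 0 ≤ DE)
    (hT₁ : HasRange R' FT) (hT₂ : IsLocal ρ FT) (hT₃ : IsBounded B FT)
    (hE₁ : HasRange R'' FE) (hE₂ : IsLocal ρ' FE) (hE₃ : IsBounded B' FE)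
    (hR : 5 ≤ ϱ) (hRρ : R' + ρ ≤ ϱ) (hρ : ρ ≤ ϱ) (hR' : R' ≤ ϱ) (hRρ' : R'' + ρ' ≤ ϱ) (hρ'' : ρ' ≤ ϱ) (hR''' : R'' ≤ ϱ)
    (hD : 13 / 10 * D + 1 ≤ ϱ)
    (hT : PairRuleMotifCertificate (1 / 20) (1 / 8) (effPot w₅ ω₅ (13 / 4000)) (13 / 4000) (-(7175 / 10000) + 1 / 100) (-CT) (-(1 / 100))
      D ϱ FT)
    (hE : PairRuleMotifCertificateE (1 / 20) (1 / 8) (effPot w₅ ω₅ (13 / 4000)) (13 / 4000) (-(7175 / 10000) - DE) (-(1 / 1000 + CE))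
      (1 / 1000 + DE) D ϱ FE) :
    Summit.AtomisticToContinuum.Crystallization.Theses.FrustratedLawDichotomy.AperiodicFrustratedLawGap :=
  aperiodicFrustratedLawGap_of_schurMotifs (by norm_num) (by norm_num) hDoor hSF hU (by norm_num) (by norm_num) hCT hCE hDE
    (fun r hr => effPot_five_eq_zero _ hr) hT₁ hT₂ hT₃ hE₁ hE₂ hE₃ (by linarith) hR hRρ hρ hR' hRρ' hρ'' hR''' hD hT hE

end Summit.AtomisticToContinuum.Crystallization.Theorems.FrustratedLawDichotomyMotifDoorE

end
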